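import Summits.QuantumFields.YangMills.Theorems.Instrument.ClosedComplexCountBound
import Mathlib.Algebra.BigOperators.Ring.Finset
import HarnessLib

/-!
# Instrument cell `ym-instrument`, crew (b): the link-by-link EXPLORATION of a plaquette complex of `ℤ⁴` through ADMISSIBLE links and its KRAFT
# INEQUALITY (part 1 of the discharge of the tree's tail obligation `TailBoundT2` and of its (G1) twin T2′; part 2 = `ClosedComplexTailBound`)

QUESTIONS.md: Q-B1 (A-0826-8 reading (i) REACH; the certs/b radius∕rate rows of record carry `conditional_on ["T2"]` = the tree's NAMED OBLIGATION
`Balaban1983to89.StrongCouplingKPWindow.TailBoundT2`, `closedCount 4 n ≤ (7/10)·(299/20)^n`).  Cell `run/shared/lean/pub/ym-instrument/`, HUMAN RULING D-0084 (2),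
director-ym R138.  HONEST FRAMING (page 1, binding).  WHAT IS CERTIFIED HERE AND AT WHICH `(G, D, L, β)`: PURE COMBINATORICS of `ℤ⁴` (no group, no
coupling, no volume) — the machine of the paper proof `pub-balaban/ir/data/FRONT-SC-taillemma.txt` steps (1), (4), GENERIC in a link predicate `Adm`
(«admissible» links: ALL links for `TailBoundT2`; the FREE links of the axial-2 comb gauge for S2-SPEC's (G1) class = sc-eng-2's T2′, 2026-08-27T00:09:38Z):
the exploration of a target plaquette set `X` admissible link by admissible link (state = plaquettes born so far `Y` + links decided `D`; a block decides one
undecided ADMISSIBLE link of `Y` (`und`, `sel`, `step`): the plaquettes of `X` through it not yet born are born), the block weight `bw c m = [2 ≤ c + m]·x^m·y^c` (`c` plaquettes already present at the decided link, `m` new-born;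
`x = 19/100`, `y = (1+x)^{−2}` — the paper's linear programme collapsed to the pointwise `F_c(x) ≤ (1+x)^{2c}`), the run weight `wt` (product of block
weights, `1` at a terminal state whose born set is the target), and ★ the KRAFT INEQUALITY `kraft`: from any state with any fuel the run weights of any
family of distinct targets sum to `≤ 1` — because a link of `ℤ⁴` lies in `≤ 6` plaquettes (`LatticeGaugeDobrushin.card_plaquettesTouching_singleton_le`), so
the block weights at a state sum to `≤ 1` (`kraft_step`; binding cases `(c, 6 − c) = (1, 5)`: `0.979`, `(2, 4)`: equality) — and `≤ 7/10` with the root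
block (`kraft_root_sum`: `(1.19)^6 − 1 − 6·0.19 = 0.69976…`).  Part 2 shows that the run of an `Adm`-CONNECTED `n`-complex CLOSED ON ITS ADMISSIBLE LINKS through an
admissible root link has weight `≥ x^n y^{3n}` and concludes the count `≤ (7/10)·(299/20)^n` for every `Adm` — `TailBoundT2` at `Adm = ⊤`.  NOT a statement about any gauge theory, NOT a radius, NOT summit-bearing.  Grade (T).
-/

noncomputable section

open Finset
open Literature.MathematicalPhysics.QuantumLattice (ZdEdge ZdPlaquette plaquetteEdges plaquettesTouching)
open Literature.MathematicalPhysics.QuantumFieldTheory (mem_plaquettesTouching_singleton card_plaquettesTouching_singleton_le card_plaquetteEdges_le)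
open Literature.MathematicalPhysics.QuantumFieldTheory.Balaban1983to89.StrongCouplingKPWindow
  (links IsLinkConnected IsClosedComplex rootLink closedCount TailBoundT2)
open Summit.QuantumFields.YangMills.Theorems.Instrument.ClosedComplexCountBound (coverFamily mem_coverFamily)

namespace Summit.QuantumFields.YangMills.Theorems.Instrument.ClosedComplexExploration

/-! ## §1 The exploration process -/

/-- The plaquettes of `Y` through the link `l`. [folklore] -/
abbrev atLink (Y : Finset (ZdPlaquette 4)) (l : ZdEdge 4) : Finset (ZdPlaquette 4) := Y.filter fun p => l ∈ plaquetteEdges p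

/-- A state of the exploration: the plaquettes born so far and the links already decided. [folklore] -/
structure State where
  /-- plaquettes born so far -/
  Y : Finset (ZdPlaquette 4)
  /-- links already decided -/
  D : Finset (ZdEdge 4)

variable (Adm : ZdEdge 4 → Prop) [DecidablePred Adm]

/-- The undecided links of a state: ADMISSIBLE links of the born plaquettes not yet decided. [folklore] -/
def und (s : State) : Finset (ZdEdge 4) := (links s.Y).filter Adm \ s.D

/-- A selection rule: some element of a nonempty link set (which one is immaterial). [folklore] -/
def sel (U : Finset (ZdEdge 4)) : ZdEdge 4 := if h : U.Nonempty then h.choose else rootLink 4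

/-- The selected link belongs to the set. [folklore] -/
theorem sel_mem {U : Finset (ZdEdge 4)} (h : U.Nonempty) : sel U ∈ U := by
  unfold sel; rw [dif_pos h]; exact h.choose_spec

/-- One block of the exploration of the target `X`: decide the selected undecided link, the plaquettes of `X` through it are born. [folklore] -/
def step (s : State) (X : Finset (ZdPlaquette 4)) : State :=
  ⟨s.Y ∪ atLink (X \ s.Y) (sel (und Adm s)), insert (sel (und Adm s)) s.D⟩

/-- The Kraft parameter `x = 19/100`. [folklore] -/
def xK : ℝ := 19 / 100

/-- The per-present-plaquette factor `y = (1 + x)^{−2} = (100/119)²`. [folklore] -/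
def yK : ℝ := (100 / 119) ^ 2

/-- `0 < x`. [folklore] -/
theorem xK_pos : 0 < xK := by unfold xK; norm_num

/-- `0 < y`. [folklore] -/
theorem yK_pos : 0 < yK := by unfold yK; positivity

/-- `y ≤ 1`. [folklore] -/
theorem yK_le_one : yK ≤ 1 := by unfold yK; norm_num

/-- The weight of a block with `c` plaquettes already present at the decided link and `m` new-born ones: `[2 ≤ c + m]·x^m·y^c`. [folklore] -/
def bw (c m : ℕ) : ℝ := if 2 ≤ c + m then xK ^ m * yK ^ c else 0

/-- Block weights are nonnegative. [folklore] -/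
theorem bw_nonneg (c m : ℕ) : 0 ≤ bw c m := by
  unfold bw; split_ifs
  · exact mul_nonneg (pow_nonneg xK_pos.le _) (pow_nonneg yK_pos.le _)
  · exact le_rfl

/-- The weight of the run towards the target `X` from the state `s` with fuel `k`: product of the block weights, `1` at a terminal state whose born set
IS the target, `0` otherwise (wrong target or fuel exhausted). [folklore] -/
def wt : ℕ → State → Finset (ZdPlaquette 4) → ℝ
  | 0, s, X => if und Adm s = ∅ then (if s.Y = X then 1 else 0) else 0
  | k + 1, s, X => if und Adm s = ∅ then (if s.Y = X then 1 else 0) else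
      bw (atLink s.Y (sel (und Adm s))).card (atLink (X \ s.Y) (sel (und Adm s))).card * wt k (step Adm s X) X

/-- At a terminal state the weight is the indicator of the target. [folklore] -/
theorem wt_terminal {k : ℕ} {s : State} {X : Finset (ZdPlaquette 4)} (h : und Adm s = ∅) : wt Adm k s X = if s.Y = X then 1 else 0 := by
  cases k <;> simp [wt, h]

/-- One block at a non-terminal state. [folklore] -/
theorem wt_succ {k : ℕ} {s : State} {X : Finset (ZdPlaquette 4)} (h : und Adm s ≠ ∅) :
    wt Adm (k + 1) s X = bw (atLink s.Y (sel (und Adm s))).card (atLink (X \ s.Y) (sel (und Adm s))).card * wt Adm k (step Adm s X) X := by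
  simp [wt, h]

/-- Run weights are nonnegative. [folklore] -/
theorem wt_nonneg : ∀ (k : ℕ) (s : State) (X : Finset (ZdPlaquette 4)), 0 ≤ wt Adm k s X
  | 0, s, X => by unfold wt; split_ifs <;> norm_num
  | k + 1, s, X => by
    by_cases h : und Adm s = ∅
    · rw [wt_terminal Adm h]; split_ifs <;> norm_num
    · rw [wt_succ Adm h]; exact mul_nonneg (bw_nonneg _ _) (wt_nonneg k _ _)

/-! ## §2 The Kraft inequality -/

/-- `Σ_{S ⊆ A} x^{|S|} = (1 + x)^{|A|}` (binomial theorem over the powerset). [folklore] -/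
theorem sum_powerset_xK (A : Finset (ZdPlaquette 4)) : ∑ S ∈ A.powerset, xK ^ S.card = (xK + 1) ^ A.card := by
  have h := Finset.sum_pow_mul_eq_add_pow xK 1 A
  simpa using h

/-- Block weights with `c ≥ 2` plaquettes present: the indicator is `1`. [folklore] -/
theorem bw_of_two_le {c : ℕ} (hc : 2 ≤ c) (m : ℕ) : bw c m = xK ^ m * yK ^ c := by
  unfold bw; rw [if_pos (by omega)]

/-- Block weights with one plaquette present: `x^m y − [m = 0]·y`. [folklore] -/
theorem bw_one (m : ℕ) : bw 1 m = xK ^ m * yK - if m = 0 then yK else 0 := by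
  unfold bw
  rcases Nat.eq_zero_or_pos m with rfl | hm
  · simp
  · rw [if_pos (by omega), if_neg (by omega), pow_one, sub_zero]

/-- Root-block weights: `x^m − [m = 0] − [m = 1]·x`. [folklore] -/
theorem bw_zero (m : ℕ) : bw 0 m = xK ^ m - (if m = 0 then 1 else 0) - (if m = 1 then xK else 0) := by
  unfold bw
  rcases Nat.lt_or_ge m 2 with hm | hm
  · interval_cases m <;> simp
  · rw [if_pos (by omega), if_neg (by omega), if_neg (by omega), pow_zero, mul_one, sub_zero, sub_zero]

/-- `Σ_{S ⊆ A} bw 0 |S| = (1+x)^{|A|} − 1 − |A|·x`. [folklore] -/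
theorem sum_bw_zero (A : Finset (ZdPlaquette 4)) : ∑ S ∈ A.powerset, bw 0 S.card = (xK + 1) ^ A.card - 1 - A.card * xK := by
  simp_rw [bw_zero, sum_sub_distrib, sum_powerset_xK]
  have h0 : ∑ S ∈ A.powerset, (if S.card = 0 then (1 : ℝ) else 0) = 1 := by
    rw [sum_ite, sum_const_zero, add_zero, sum_const, nsmul_eq_mul, mul_one, ← powersetCard_eq_filter, card_powersetCard,
      Nat.choose_zero_right, Nat.cast_one]
  have h1 : ∑ S ∈ A.powerset, (if S.card = 1 then xK else 0) = A.card * xK := by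
    rw [sum_ite, sum_const_zero, add_zero, sum_const, nsmul_eq_mul, ← powersetCard_eq_filter, card_powersetCard, Nat.choose_one_right]
  rw [h0, h1]

/-- `Σ_{S ⊆ A} bw 1 |S| = ((1+x)^{|A|} − 1)·y`. [folklore] -/
theorem sum_bw_one (A : Finset (ZdPlaquette 4)) : ∑ S ∈ A.powerset, bw 1 S.card = ((xK + 1) ^ A.card - 1) * yK := by
  simp_rw [bw_one, sum_sub_distrib, ← sum_mul, sum_powerset_xK]
  have h0 : ∑ S ∈ A.powerset, (if S.card = 0 then yK else 0) = yK := by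
    rw [sum_ite, sum_const_zero, add_zero, sum_const, nsmul_eq_mul, ← powersetCard_eq_filter, card_powersetCard,
      Nat.choose_zero_right, Nat.cast_one, one_mul]
  rw [h0]; ring

/-- `Σ_{S ⊆ A} bw c |S| = (1+x)^{|A|}·y^c` for `c ≥ 2`. [folklore] -/
theorem sum_bw_two_le {c : ℕ} (hc : 2 ≤ c) (A : Finset (ZdPlaquette 4)) :
    ∑ S ∈ A.powerset, bw c S.card = (xK + 1) ^ A.card * yK ^ c := by
  simp_rw [bw_of_two_le hc, ← sum_mul, sum_powerset_xK]

/-- The root block (at most six plaquettes through the root link): `Σ_{|S| ≥ 2} x^{|S|} ≤ (1.19)^6 − 1 − 6·(0.19) = 0.69976… ≤ 7/10`. [folklore] -/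
theorem kraft_root (A : Finset (ZdPlaquette 4)) (hA : A.card ≤ 6) : ∑ S ∈ A.powerset, bw 0 S.card ≤ 7 / 10 := by
  rw [sum_bw_zero]
  obtain ⟨a, ha⟩ : ∃ a, A.card = a := ⟨_, rfl⟩
  rw [ha] at hA ⊢
  interval_cases a <;> (unfold xK; norm_num)

/-- **The per-block Kraft inequality** `Σ_{S ⊆ A} [2 ≤ c + |S|]·x^{|S|}·y^c ≤ 1` whenever `|A| + c ≤ 6` (`x = 19/100`, `y = (1+x)^{−2}`; binding cases
`(c, |A|) = (1, 5)`: `((1.19)^5 − 1)/(1.19)^2 = 0.979`, and `(2, 4)`: equality — the paper's LP vertex `ν₂ = 3/2`). [folklore] -/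
theorem kraft_step (c : ℕ) (A : Finset (ZdPlaquette 4)) (h : A.card + c ≤ 6) : ∑ S ∈ A.powerset, bw c S.card ≤ 1 := by
  have h1x : (1 : ℝ) ≤ xK + 1 := by unfold xK; norm_num
  rcases Nat.lt_or_ge c 2 with hc | hc
  · interval_cases c
    · exact (kraft_root A (by omega)).trans (by norm_num)
    · rw [sum_bw_one]
      calc ((xK + 1) ^ A.card - 1) * yK ≤ ((xK + 1) ^ 5 - 1) * yK :=
            mul_le_mul_of_nonneg_right (sub_le_sub_right (pow_le_pow_right₀ h1x (by omega)) _) yK_pos.le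
        _ ≤ 1 := by unfold xK yK; norm_num
  · rw [sum_bw_two_le hc]
    calc (xK + 1) ^ A.card * yK ^ c ≤ (xK + 1) ^ 4 * yK ^ 2 :=
          mul_le_mul (pow_le_pow_right₀ h1x (by omega)) (pow_le_pow_of_le_one yK_pos.le yK_le_one hc) (pow_nonneg yK_pos.le _)
            (pow_nonneg (zero_le_one.trans h1x) _)
      _ = 1 := by unfold xK yK; norm_num

/-- At most six plaquettes of `ℤ⁴` through a link, split into those already born and the rest. [folklore] -/
theorem card_sdiff_add_card_atLink_le (Y : Finset (ZdPlaquette 4)) (l : ZdEdge 4) :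
    (plaquettesTouching {l} \ Y).card + (atLink Y l).card ≤ 6 := by
  have hsub : plaquettesTouching {l} \ Y ∪ atLink Y l ⊆ plaquettesTouching {l} := by
    intro p hp
    rcases mem_union.1 hp with hp | hp
    · exact (mem_sdiff.1 hp).1
    · exact mem_plaquettesTouching_singleton.2 (mem_filter.1 hp).2
  have hdisj : Disjoint (plaquettesTouching {l} \ Y) (atLink Y l) := disjoint_sdiff_self_left.mono_right (filter_subset _ _)
  rw [← card_union_of_disjoint hdisj]
  exact (card_le_card hsub).trans ((card_plaquettesTouching_singleton_le l).trans (by norm_num))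

/-- **Kraft inequality.** From any state, with any fuel, the run weights of any family of distinct targets sum to at most `1`. [folklore] -/
theorem kraft : ∀ (k : ℕ) (s : State) (𝒳 : Finset (Finset (ZdPlaquette 4))), ∑ X ∈ 𝒳, wt Adm k s X ≤ 1 := by
  have hterm : ∀ (k : ℕ) (s : State) (𝒳 : Finset (Finset (ZdPlaquette 4))), und Adm s = ∅ → ∑ X ∈ 𝒳, wt Adm k s X ≤ 1 := by
    intro k s 𝒳 h
    simp_rw [wt_terminal Adm h]
    rw [sum_ite_eq]
    split_ifs <;> norm_num
  intro k
  induction k with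
  | zero =>
    intro s 𝒳
    by_cases h : und Adm s = ∅
    · exact hterm 0 s 𝒳 h
    · have : ∀ X ∈ 𝒳, wt Adm 0 s X = 0 := fun X _ => by simp [wt, h]
      rw [sum_congr rfl this, sum_const_zero]; exact zero_le_one
  | succ k ih =>
    intro s 𝒳
    by_cases h : und Adm s = ∅
    · exact hterm (k + 1) s 𝒳 h
    · have hrw0 : ∀ X ∈ 𝒳, wt Adm (k + 1) s X =
          bw (atLink s.Y (sel (und Adm s))).card (atLink (X \ s.Y) (sel (und Adm s))).card *
            wt Adm k ⟨s.Y ∪ atLink (X \ s.Y) (sel (und Adm s)), insert (sel (und Adm s)) s.D⟩ X := fun X _ => wt_succ Adm h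
      rw [sum_congr rfl hrw0]
      generalize sel (und Adm s) = l
      have hmaps : ∀ X ∈ 𝒳, atLink (X \ s.Y) l ∈ (plaquettesTouching {l} \ s.Y).powerset := by
        intro X _
        rw [mem_powerset]
        intro p hp
        obtain ⟨hp1, hp2⟩ := mem_filter.1 hp
        exact mem_sdiff.2 ⟨mem_plaquettesTouching_singleton.2 hp2, (mem_sdiff.1 hp1).2⟩
      rw [← sum_fiberwise_of_maps_to hmaps]
      have hfib : ∀ S ∈ (plaquettesTouching {l} \ s.Y).powerset,
          ∑ X ∈ 𝒳 with atLink (X \ s.Y) l = S,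
              bw (atLink s.Y l).card (atLink (X \ s.Y) l).card * wt Adm k ⟨s.Y ∪ atLink (X \ s.Y) l, insert l s.D⟩ X
            ≤ bw (atLink s.Y l).card S.card := by
        intro S _
        have hrw : ∀ X ∈ 𝒳.filter (fun X => atLink (X \ s.Y) l = S),
            bw (atLink s.Y l).card (atLink (X \ s.Y) l).card * wt Adm k ⟨s.Y ∪ atLink (X \ s.Y) l, insert l s.D⟩ X =
              bw (atLink s.Y l).card S.card * wt Adm k ⟨s.Y ∪ S, insert l s.D⟩ X := by
          intro X hX
          rw [(mem_filter.1 hX).2]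
        rw [sum_congr rfl hrw, ← mul_sum]
        calc bw (atLink s.Y l).card S.card * ∑ X ∈ 𝒳 with atLink (X \ s.Y) l = S, wt Adm k ⟨s.Y ∪ S, insert l s.D⟩ X
            ≤ bw (atLink s.Y l).card S.card * 1 := mul_le_mul_of_nonneg_left (ih _ _) (bw_nonneg _ _)
          _ = bw (atLink s.Y l).card S.card := mul_one _
      exact (sum_le_sum hfib).trans (kraft_step _ _ (card_sdiff_add_card_atLink_le s.Y l))

/-- The initial state of the exploration of `X` from the root link `e`: the plaquettes of `X` through `e` are born, `e` is decided. [folklore] -/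
def init (e : ZdEdge 4) (X : Finset (ZdPlaquette 4)) : State := ⟨atLink X e, {e}⟩

/-- The total weight of the target `X` among `n`-complexes through `e`: root block `[2 ≤ m₀]·x^{m₀}` times the run weight from the initial state with
fuel `4n`. [folklore] -/
def W (e : ZdEdge 4) (n : ℕ) (X : Finset (ZdPlaquette 4)) : ℝ := bw 0 (atLink X e).card * wt Adm (4 * n) (init e X) X

/-- **Kraft inequality with the root block**: the total weights of any family of distinct targets sum to at most `7/10`. [folklore] -/
theorem kraft_root_sum (e : ZdEdge 4) (n : ℕ) (𝒳 : Finset (Finset (ZdPlaquette 4))) : ∑ X ∈ 𝒳, W Adm e n X ≤ 7 / 10 := by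
  have hmaps : ∀ X ∈ 𝒳, atLink X e ∈ (plaquettesTouching {e}).powerset := by
    intro X _
    rw [mem_powerset]
    intro p hp
    exact mem_plaquettesTouching_singleton.2 (mem_filter.1 hp).2
  rw [← sum_fiberwise_of_maps_to hmaps]
  have hfib : ∀ S ∈ (plaquettesTouching {e}).powerset, ∑ X ∈ 𝒳 with atLink X e = S, W Adm e n X ≤ bw 0 S.card := by
    intro S _
    have hrw : ∀ X ∈ 𝒳.filter (fun X => atLink X e = S), W Adm e n X = bw 0 S.card * wt Adm (4 * n) ⟨S, {e}⟩ X := by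
      intro X hX
      have hS : atLink X e = S := (mem_filter.1 hX).2
      unfold W init
      rw [hS]
    rw [sum_congr rfl hrw, ← mul_sum]
    calc bw 0 S.card * ∑ X ∈ 𝒳 with atLink X e = S, wt Adm (4 * n) ⟨S, {e}⟩ X
        ≤ bw 0 S.card * 1 := mul_le_mul_of_nonneg_left (kraft Adm _ _ _) (bw_nonneg _ _)
      _ = bw 0 S.card := mul_one _
  exact (sum_le_sum hfib).trans (kraft_root _ ((card_plaquettesTouching_singleton_le e).trans (by norm_num)))

end Summit.QuantumFields.YangMills.Theorems.Instrument.ClosedComplexExploration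

end
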